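import Literature.LinearAlgebra.Matrix.GL2ZSL2ZClassSplitting
import HarnessLib

/-!
# Hertling–Larabi 2026b THEOREM 7.9 (a)(iii), (b) with THEOREM 7.10 (c)(iii), COUNTED: for `D = r² − 4s < 0` the
# `GL₂(ℤ)`-conjugacy classes of integer `2 × 2` matrices with characteristic polynomial `t² − rt + s` and PRIMITIVE
# form `[c, d − a, −b]` (⟺ `𝒪(L) = ℤ[λ₁]`) are counted by the form class number `h(D)`, the classes whose form has
# content `f` by `h(D/f²)`, and ALL classes by `Σ_{f² ∣ D} h(D/f²)`

[topic LinearAlgebra/Matrix] Sequel to `SL2ZIrreducibleNormalForms` (Thm. 7.10: the (semi-)normal forms `M(r, s)`, one per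
`SL₂(ℤ)`-class for `D < 0`), `GL2ZSL2ZClassSplitting` (Thm. 7.9 (b): the `GL₂(ℤ)`-classes are the classes of the
normal forms with `c > 0`, `natCard_quot_gl2_conj_eq`) and `IntegerMatrixBinaryQuadraticForms` (Lemma 7.2 (b): the
form `[c, d − a, −b]` of `(a b; c d)`, `q_{γ⁻¹Bγ} = q_B·γ`), joined to the tree's form class number
`BinQF.classNumber D = h(D)` of `Literature.NumberTheory.QuadraticFields.BinaryQuadraticFormsClassNumber` (Cox
Thm. 2.13: the number of REDUCED primitive positive definite forms of discriminant `D`, computable).  Lane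
`lit-hodgefound` (Track 2 foundations library), seat p19 generation 39, row g39-#7.  THEOREMS ONLY: no definition,
no instance, no notation, no named fact (D-0026, net Literature debt `0`), no `sorry`.

Conventions: `B = (a b; c d)`, `a = B 0 0, b = B 0 1, c = B 1 0, d = B 1 1`; the form of `B` is
`(⟨B 1 0, B 1 1 - B 0 0, -B 0 1⟩ : BinQF) = [c, d − a, −b]`; its CONTENT is
`Nat.gcd (Nat.gcd |c| |d − a|) |b|` (so `BinQF.IsPrimitive` is literally «content `= 1`»); `GL₂(ℤ)`-conjugacy is
`∃ P, det P ∈ ℤˣ ∧ P B = B' P`; `M(r, s)` is spelled out as in the predecessors.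

## Source, VERBATIM

C. Hertling, K. Larabi, *Conjugacy classes of regular integer matrices*, arXiv:2602.15748 (2026)
[HertlingLarabi2026b], held `paper:arxiv-2602.15748`, §7.2–7.3, chunks p0015–p0018:
«**Theorem 7.7.** […] (b) The orders in `A` are the full lattices `Λ_n := ⟨1, nω⟩_ℤ` for `n ∈ ℕ`.»
«**Theorem 7.9.** […] (a) Let `B = (a b; c d) ∈ M_{2×2}(ℤ)` with characteristic polynomial `f` […]. (i) The full
lattice `L := ⟨c, −a + λ_1⟩_ℤ` […] corresponds to the `SL_2(ℤ)`-conjugacy class of `B` and to the proper equivalence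
class of the binary quadratic form `[c, d − a, −b]_quad`. […] (iii) The condition `gcd(c, b, a − d) = 1` (then the
binary quadratic form `[c, d − a, −b]_quad` is primitive) is equivalent to `𝒪(L) = ℤ[λ_1]`.
(b) Consider the case `D < 0` […]. Each `GL_2(ℤ)`-conjugacy class of matrices with characteristic polynomial `f`
splits into two `SL_2(ℤ)` conjugacy classes. One contains matrices `(a b; c d)` with `c > 0` and corresponds to
`(ε+)`-classes of pairs `(L, o_1)` and to proper equivalence classes of positive definite binary quadratic forms.
[…]»
«**Theorem 7.10.** […] (c) […] (iii) In the case of type V there is exactly one such representative [in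
`M(r, s)`]. It is called normal form.»
D. A. Cox, *Primes of the form x² + ny²* [Cox2013], §2.A (2.4) and Thm. 2.8: «every primitive positive definite
form is properly equivalent to a unique reduced form», Thm. 2.13: `h(D)` «is equal to the number of reduced forms of
discriminant `D`» — the tree's `BinQF.IsReduced` (`|b| ≤ a ≤ c`, and `b ≥ 0` if `|b| = a` or `a = c`),
`reducedFormsList`, `classNumber_eq_card`.

The dictionary.  For `(a b; c d) ∈ M(r, s)` with `c > 0` (so `b < 0` when `D < 0`) the conditions of `M(r, s)`
(`|c| ≤ |b|`, `a − d ∈ (−|c|, |c|]`, `a − d ≥ 0` if `|c| = |b|`) say exactly that `(c, a − d, −b)` — the form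
`[c, d − a, −b]` after `y ↦ −y` — is Cox-reduced (`SL2ZIrreducibleNormalForms.mem_normalForms_iff_isReduced`);
dividing by the content `f` gives a reduced PRIMITIVE positive definite form of discriminant `D/f²`, and conversely
(the parity `fβ ≡ r (mod 2)` needed to rebuild `a = (r + fβ)/2` follows from `f²(β² − 4αγ) = r² − 4s`).

## What is proved

* §0 `isPrimitive_of_sl2_conj` (primitivity of `[c, d − a, −b]` is an `SL₂(ℤ)`-conjugacy invariant — 7.9 (a)(iii)).
* §1 **`natCard_normalForms_pos_content_eq_classNumber`**: for `D = r² − 4s < 0`, `f ≥ 1`, `f² ∣ D`, the normal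
  forms in `M(r, s)` with `c > 0` and content `f` are `h(D/f²)` in number (explicit bijection with
  `reducedFormsList (D/f²)`); **`natCard_normalForms_pos_primitive_eq_classNumber`** (`f = 1`: `h(D)`).
* §2 **`natCard_quot_gl2_conj_primitive_eq_classNumber`** — THEOREM 7.9 (a)(iii)(b) + 7.10 (c)(iii), counted: the
  `GL₂(ℤ)`-classes with characteristic polynomial `t² − rt + s` (`D < 0`) and primitive form (`𝒪(L) = ℤ[λ₁]`) are
  `h(D)` in number.
* §3 **`natCard_quot_gl2_conj_eq_sum_classNumber`** — ALL `GL₂(ℤ)`-classes: `Σ_{1 ≤ f, f² ∣ D} h(D/f²)` (one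
  summand per order `Λ_f ⊇ ℤ[λ₁]`, Theorem 7.7 (b)).
* §4 `classNumber_examples_7_11` (`h(−20) = 2`, `h(−80) = 4`, `h(−5) = 0`), `sum_classNumber_zero_twenty`
  (`Σ_{f² ∣ 80} h(−80/f²) = 6` — Examples 7.11 (ii): «6 `GL_2(ℤ)`-conjugacy classes of matrices with characteristic
  polynomial `t² + 20`», cf. `SL2ZNormalFormsEnumeration.natCard_quot_gl2_conj_zero_twenty`).

## References

* [HertlingLarabi2026b] C. Hertling, K. Larabi, arXiv:2602.15748 (2026), §7.2 Theorems 7.7 (b), 7.9 (a)(iii)(b),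
  §7.3 Theorem 7.10 (c)(iii), Examples 7.11 (chunks p0015–p0019). [cite: HertlingLarabi2026b, §7.2 Theorem 7.9 (a)(iii)(b), §7.3 Theorem 7.10 (c)(iii), chunks p0016–p0018]
* [Cox2013] D. A. Cox, *Primes of the form x² + ny²*, 2nd ed., Wiley 2013, §2.A eq. (2.4), Thm. 2.8, Thm. 2.13.
  [cite: Cox2013, §2.A Thm. 2.8, Thm. 2.13]
-/

namespace Literature.LinearAlgebra.Matrix.GL2ZClassNumberBinaryForms

open Literature.NumberTheory.QuadraticFields.Quadratic (BinQF)
open Literature.NumberTheory.QuadraticFields.Quadratic.BinQF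
open Literature.LinearAlgebra.Matrix.IntegerMatrixBinQF
open Literature.LinearAlgebra.Matrix.SL2ZIrreducibleNormalForms
open Literature.LinearAlgebra.Matrix.GL2ZSL2ZClassSplitting

/-! ## §0 Tools -/

/-- Cox-reducedness is invariant under scaling a form by a positive integer. [cite: Cox2013, §2.A eq. (2.4)] -/
private theorem isReduced_mul_iff {f : ℤ} (hf : 0 < f) (α β γ : ℤ) :
    (⟨f * α, f * β, f * γ⟩ : BinQF).IsReduced ↔ (⟨α, β, γ⟩ : BinQF).IsReduced := by
  simp only [BinQF.IsReduced, abs_mul, abs_of_pos hf]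
  have h1 : f * |β| ≤ f * α ↔ |β| ≤ α := mul_le_mul_iff_right₀ hf
  have h2 : f * α ≤ f * γ ↔ α ≤ γ := mul_le_mul_iff_right₀ hf
  have h3 : f * |β| = f * α ↔ |β| = α := mul_right_inj' hf.ne'
  have h4 : f * α = f * γ ↔ α = γ := mul_right_inj' hf.ne'
  have h5 : 0 ≤ f * β ↔ 0 ≤ β := mul_nonneg_iff_of_pos_left hf
  rw [h1, h2, h3, h4, h5]

/-- `x² ≡ y² (mod 4)` forces `x ≡ y (mod 2)`. [folklore] -/
private theorem even_sub_of_sq_sub_sq {x y k : ℤ} (h : x ^ 2 - y ^ 2 = 4 * k) : Even (x - y) := by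
  by_contra hodd
  rw [Int.not_even_iff_odd] at hodd
  have h2 : Odd (x + y) := by
    have e : x + y = (x - y) + 2 * y := by ring
    rw [e]; exact hodd.add_even (even_two_mul y)
  have h3 : Odd ((x - y) * (x + y)) := hodd.mul h2
  have h4 : Even ((x - y) * (x + y)) := ⟨2 * k, by linear_combination h⟩
  exact (Int.not_even_iff_odd.2 h3) h4

/-- `GL₂(ℤ)`-conjugacy is an equivalence relation on any set of integer `2 × 2` matrices.
[cite: HertlingLarabi2026b, §6 Def./Lemma 6.1 (e), chunk p0012] -/
private theorem gl_equivalence (p : Matrix (Fin 2) (Fin 2) ℤ → Prop) :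
    Equivalence fun B B' : {B : Matrix (Fin 2) (Fin 2) ℤ // p B} =>
      ∃ P : Matrix (Fin 2) (Fin 2) ℤ, IsUnit P.det ∧ P * B.1 = B'.1 * P where
  refl B := ⟨1, by rw [Matrix.det_one]; exact isUnit_one, by rw [Matrix.one_mul, Matrix.mul_one]⟩
  symm := by
    rintro B B' ⟨P, hP, h⟩
    refine ⟨P.adjugate, by rw [Matrix.det_adjugate, Fintype.card_fin]; simpa using hP, ?_⟩
    have h1 : P.det • (B.1 * P.adjugate) = P.det • (P.adjugate * B'.1) := by
      calc P.det • (B.1 * P.adjugate) = P.adjugate * P * B.1 * P.adjugate := by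
            rw [Matrix.adjugate_mul, Matrix.smul_mul, Matrix.one_mul, Matrix.smul_mul]
        _ = P.adjugate * (P * B.1) * P.adjugate := by simp only [Matrix.mul_assoc]
        _ = P.adjugate * (B'.1 * P) * P.adjugate := by rw [h]
        _ = P.adjugate * B'.1 * (P * P.adjugate) := by simp only [Matrix.mul_assoc]
        _ = P.det • (P.adjugate * B'.1) := by rw [Matrix.mul_adjugate, Matrix.mul_smul, Matrix.mul_one]
    rcases Int.isUnit_iff.1 hP with hd | hd <;> rw [hd] at h1
    · rw [one_smul, one_smul] at h1
      exact h1.symm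
    · rw [neg_one_smul, neg_one_smul, neg_inj] at h1
      exact h1.symm
  trans := by
    rintro B B' B'' ⟨P, hP, h⟩ ⟨P', hP', h'⟩
    refine ⟨P' * P, by rw [Matrix.det_mul]; exact hP'.mul hP, ?_⟩
    rw [Matrix.mul_assoc, h, ← Matrix.mul_assoc, h', Matrix.mul_assoc]

/-- **Primitivity of `[c, d − a, −b]` is an `SL₂(ℤ)`-conjugacy invariant** (Lemma 7.2 (b): `q_{γ⁻¹Bγ} = q_B·γ`;
Theorem 7.9 (a)(iii): it means `𝒪(L) = ℤ[λ₁]`). [cite: HertlingLarabi2026b, §7.1 Lemma 7.2 (b) and §7.2 Theorem 7.9 (a)(iii), chunks p0014, p0016] -/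
theorem isPrimitive_of_sl2_conj {B B' γ : Matrix (Fin 2) (Fin 2) ℤ} (hγ : γ.det = 1) (h : γ * B' = B * γ)
    (hB : (⟨B 1 0, B 1 1 - B 0 0, -B 0 1⟩ : BinQF).IsPrimitive) :
    (⟨B' 1 0, B' 1 1 - B' 0 0, -B' 0 1⟩ : BinQF).IsPrimitive := by
  have hB' : B' = γ.adjugate * B * γ := by
    have e := eq_smul_adjugate_mul_mul (B := B) (B' := B') (γ := γ) (by rw [hγ, one_pow]) h
    rwa [hγ, one_smul] at e
  rw [hB', binQF_adjugate_mul_mul]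
  rw [Matrix.det_fin_two] at hγ
  exact hB.act hγ

/-! ## §1 Normal forms with `c > 0` and content `f` ↔ reduced primitive forms of discriminant `D/f²` -/

/-- **The (semi-)normal forms `(a b; c d) ∈ M(r, s)` with `c > 0` whose form `[c, d − a, −b]` has content `f`
(`f ≥ 1`, `f² ∣ D = r² − 4s < 0`) are equinumerous with the REDUCED PRIMITIVE positive definite forms of
discriminant `D/f²`, so their number is `h(D/f²)`** — via `(a b; c d) ↦ (c/f, (a − d)/f, −b/f)` (Cox's reduction
convention `|β| ≤ α ≤ γ`, `β ≥ 0` on ties, matches the tie rule of `M(r, s)` after `y ↦ −y`, i.e. for the form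
`[c, a − d, −b]`).  Theorem 7.9 (b): the `SL₂(ℤ)`-class with `c > 0` «corresponds […] to proper equivalence classes
of positive definite binary quadratic forms»; Theorem 7.10 (c)(iii): one normal form per class.
[cite: HertlingLarabi2026b, §7.2 Theorem 7.9 (a)(iii)(b) and §7.3 Theorem 7.10 (b)(c)(iii), chunks p0016–p0018]
[cite: Cox2013, §2.A Thm. 2.8 / Thm. 2.13 (`h(D)` = number of reduced forms)] -/
theorem natCard_normalForms_pos_content_eq_classNumber {r s : ℤ} (hΔ : r ^ 2 - 4 * s < 0) {f : ℕ} (hf : 0 < f)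
    (hfD : ((f : ℤ)) ^ 2 ∣ r ^ 2 - 4 * s) :
    Nat.card {B : Matrix (Fin 2) (Fin 2) ℤ | B.trace = r ∧ B.det = s ∧ 0 < B 1 0 ∧ |B 1 0| ≤ |B 0 1| ∧
        -|B 1 0| < B 0 0 - B 1 1 ∧ B 0 0 - B 1 1 ≤ |B 1 0| ∧ (|B 1 0| = |B 0 1| → 0 ≤ B 0 0 - B 1 1) ∧
        Nat.gcd (Nat.gcd (B 1 0).natAbs (B 1 1 - B 0 0).natAbs) (-B 0 1).natAbs = f} =
      classNumber ((r ^ 2 - 4 * s) / (f : ℤ) ^ 2) := by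
  set D := r ^ 2 - 4 * s with hD
  obtain ⟨D', hD'⟩ := hfD
  have hf0 : (f : ℤ) ≠ 0 := by exact_mod_cast hf.ne'
  have hfz : (0 : ℤ) < f := by exact_mod_cast hf
  have hf2 : ((f : ℤ)) ^ 2 ≠ 0 := pow_ne_zero 2 hf0
  have hDf : D / (f : ℤ) ^ 2 = D' := by rw [hD', Int.mul_ediv_cancel_left _ hf2]
  have hD'neg : D' < 0 := by
    by_contra h
    push Not at h
    have : 0 ≤ D := by rw [hD']; positivity
    exact absurd hΔ (not_lt.2 this)
  rw [hDf, classNumber_eq_card, ← Nat.card_eq_finsetCard]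
  set N := {B : Matrix (Fin 2) (Fin 2) ℤ | B.trace = r ∧ B.det = s ∧ 0 < B 1 0 ∧ |B 1 0| ≤ |B 0 1| ∧
    -|B 1 0| < B 0 0 - B 1 1 ∧ B 0 0 - B 1 1 ≤ |B 1 0| ∧ (|B 1 0| = |B 0 1| → 0 ≤ B 0 0 - B 1 1) ∧
    Nat.gcd (Nat.gcd (B 1 0).natAbs (B 1 1 - B 0 0).natAbs) (-B 0 1).natAbs = f} with hN
  -- the entries of `B ∈ N` divided by `f`
  have hdiv : ∀ B : N, ∃ α β γ : ℤ, B.1 1 0 = f * α ∧ B.1 0 0 - B.1 1 1 = f * β ∧ B.1 0 1 = f * γ ∧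
      Nat.gcd (Nat.gcd α.natAbs β.natAbs) γ.natAbs = 1 ∧ 0 < α ∧ γ < 0 ∧
      (⟨α, β, -γ⟩ : BinQF).IsReduced ∧ β ^ 2 - 4 * α * (-γ) = D' := by
    rintro ⟨B, htr, hdet, hc, hcb, h₁, h₂, h₃, hg⟩
    simp only
    have hfc : (f : ℤ) ∣ B 1 0 := by
      rw [← Int.natAbs_dvd_natAbs, Int.natAbs_natCast, ← hg]
      exact (Nat.gcd_dvd_left _ _).trans (Nat.gcd_dvd_left _ _)
    have hfβ : (f : ℤ) ∣ B 0 0 - B 1 1 := by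
      have e : (B 0 0 - B 1 1).natAbs = (B 1 1 - B 0 0).natAbs := by rw [← Int.natAbs_neg, neg_sub]
      rw [← Int.natAbs_dvd_natAbs, Int.natAbs_natCast, e, ← hg]
      exact (Nat.gcd_dvd_left _ _).trans (Nat.gcd_dvd_right _ _)
    have hfγ : (f : ℤ) ∣ B 0 1 := by
      rw [← Int.natAbs_dvd_natAbs, Int.natAbs_natCast, ← hg, ← Int.natAbs_neg (B 0 1)]
      exact Nat.gcd_dvd_right _ _
    obtain ⟨α, hα⟩ := hfc
    obtain ⟨β, hβ⟩ := hfβ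
    obtain ⟨γ, hγ⟩ := hfγ
    have hα0 : 0 < α := pos_of_mul_pos_right (hα ▸ hc) hfz.le
    have hbc : B 0 1 * B 1 0 < 0 := entry_mul_neg (by rw [htr, hdet]; exact hΔ)
    have hγ0 : γ < 0 := by
      rw [hα, hγ] at hbc
      have : 0 < (f : ℤ) * f * α := by positivity
      nlinarith
    refine ⟨α, β, γ, hα, hβ, hγ, ?_, hα0, hγ0, ?_, ?_⟩
    · -- content
      have e : Nat.gcd (Nat.gcd (B 1 0).natAbs (B 1 1 - B 0 0).natAbs) (-B 0 1).natAbs =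
          f * Nat.gcd (Nat.gcd α.natAbs β.natAbs) γ.natAbs := by
        rw [show B 1 1 - B 0 0 = -(B 0 0 - B 1 1) by ring, hα, hβ, hγ, Int.natAbs_neg, Int.natAbs_neg,
          Int.natAbs_mul, Int.natAbs_mul, Int.natAbs_mul, Int.natAbs_natCast, Nat.gcd_mul_left,
          Nat.gcd_mul_left]
      rw [e] at hg
      exact (Nat.mul_right_inj hf.ne').1 (by rw [hg, mul_one])
    · -- reducedness
      have key := (mem_normalForms_iff_isReduced (a := β) (d := 0) (b := γ) hα0.ne').1
      rw [sub_zero, abs_of_pos hα0, abs_of_neg hγ0] at key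
      apply key
      rw [hα] at hcb h₁ h₂ h₃
      rw [hβ] at h₁ h₂ h₃
      rw [hγ] at hcb h₃
      rw [abs_mul, abs_of_pos hfz, abs_of_pos hα0] at hcb h₁ h₂ h₃
      rw [abs_mul, abs_of_pos hfz, abs_of_neg hγ0] at hcb h₃
      refine ⟨le_of_mul_le_mul_left hcb hfz, ?_, le_of_mul_le_mul_left h₂ hfz, fun h => ?_⟩
      · have : (f : ℤ) * (-α) < f * β := by linarith
        exact lt_of_mul_lt_mul_left this hfz.le
      · have h' := h₃ (by rw [h])
        exact (mul_nonneg_iff_of_pos_left hfz).1 h'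
    · -- discriminant
      have e1 : (B 0 0 + B 1 1) ^ 2 - 4 * (B 0 0 * B 1 1 - B 0 1 * B 1 0) = D := by
        rw [← Matrix.trace_fin_two, ← Matrix.det_fin_two, htr, hdet]
      have e2 : (B 0 0 + B 1 1) ^ 2 - 4 * (B 0 0 * B 1 1 - B 0 1 * B 1 0) =
          (B 0 0 - B 1 1) ^ 2 + 4 * (B 0 1 * B 1 0) := by ring
      rw [e2, hα, hβ, hγ, hD'] at e1
      have e3 : ((f : ℤ)) ^ 2 * (β ^ 2 - 4 * α * (-γ) - D') = 0 := by linear_combination e1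
      simpa [hf2, sub_eq_zero] using e3
  choose α β γ hα hβ hγ hprim hα0 hγ0 hred hdisc using hdiv
  have hmem : ∀ B : N, (⟨α B, β B, -γ B⟩ : BinQF) ∈ (reducedFormsList D').toFinset := fun B => by
    rw [List.mem_toFinset, mem_reducedFormsList_iff _ hD'neg]
    refine ⟨⟨?_, hα0 B, ?_⟩, hred B⟩
    · simp only [BinQF.disc]; linear_combination hdisc B
    · simp only [BinQF.IsPrimitive, Int.natAbs_neg]; exact hprim B
  let Φ : N → ↥(reducedFormsList D').toFinset := fun B => ⟨⟨α B, β B, -γ B⟩, hmem B⟩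
  have hΦ : Function.Bijective Φ := by
    constructor
    · intro B B' h
      have h' : (⟨α B, β B, -γ B⟩ : BinQF) = ⟨α B', β B', -γ B'⟩ := congrArg Subtype.val h
      simp only [BinQF.mk.injEq, neg_inj] at h'
      obtain ⟨h1, h2, h3⟩ := h'
      apply Subtype.ext
      have e10 : B.1 1 0 = B'.1 1 0 := by rw [hα B, hα B', h1]
      have e01 : B.1 0 1 = B'.1 0 1 := by rw [hγ B, hγ B', h3]
      have ed : B.1 0 0 - B.1 1 1 = B'.1 0 0 - B'.1 1 1 := by rw [hβ B, hβ B', h2]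
      have et : B.1 0 0 + B.1 1 1 = B'.1 0 0 + B'.1 1 1 := by
        rw [← Matrix.trace_fin_two, ← Matrix.trace_fin_two, B.2.1, B'.2.1]
      have e00 : B.1 0 0 = B'.1 0 0 := by linarith
      have e11 : B.1 1 1 = B'.1 1 1 := by linarith
      rw [Matrix.eta_fin_two B.1, Matrix.eta_fin_two B'.1, e00, e01, e10, e11]
    · rintro ⟨q, hq⟩
      rw [List.mem_toFinset, mem_reducedFormsList_iff _ hD'neg] at hq
      obtain ⟨⟨hqd, hqa, hqp⟩, hqr⟩ := hq
      have hqc : 0 < q.c := IsPosPrim.c_pos _ hD'neg ⟨hqd, hqa, hqp⟩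
      simp only [BinQF.disc] at hqd
      -- parity: `f q.b ≡ r (mod 2)`
      have hpar : Even ((f : ℤ) * q.b - r) := by
        refine even_sub_of_sq_sub_sq (k := (f : ℤ) ^ 2 * q.a * q.c - s) ?_
        have : ((f : ℤ)) ^ 2 * (q.b ^ 2 - 4 * q.a * q.c) = r ^ 2 - 4 * s := by rw [hqd, ← hD', hD]
        linear_combination this
      obtain ⟨m, hm⟩ := hpar
      -- the matrix `((r + f β)/2, −f γ; f α, (r − f β)/2)` with `(r + fβ)/2 = m + r`... : `a = r + m`? we set `a := m + r`, no:
      -- from `f β − r = 2m`: `a := r + m`, `d := -m`, so `a + d = r`, `a − d = r + 2m = f β`.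
      set a : ℤ := r + m with ha
      set d : ℤ := -m with hd
      have had : a - d = f * q.b := by rw [ha, hd]; linear_combination -hm
      have hapd : a + d = r := by rw [ha, hd]; ring
      let B : Matrix (Fin 2) (Fin 2) ℤ := !![a, -(f * q.c); f * q.a, d]
      have hB00 : B 0 0 = a := rfl
      have hB01 : B 0 1 = -(f * q.c) := rfl
      have hB10 : B 1 0 = f * q.a := rfl
      have hB11 : B 1 1 = d := rfl
      have htrB : B.trace = r := by rw [Matrix.trace_fin_two, hB00, hB11, hapd]
      have hdetB : B.det = s := by
        rw [Matrix.det_fin_two, hB00, hB01, hB10, hB11]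
        have e4 : 4 * (a * d) = r ^ 2 - (a - d) ^ 2 := by rw [← hapd]; ring
        have : 4 * (a * d - -((f : ℤ) * q.c) * (f * q.a)) = 4 * s := by
          rw [mul_sub, e4, had]
          have : ((f : ℤ)) ^ 2 * (q.b ^ 2 - 4 * q.a * q.c) = r ^ 2 - 4 * s := by rw [hqd, ← hD', hD]
          linear_combination -this
        linarith
      have hcB : 0 < B 1 0 := by rw [hB10]; positivity
      have hredB : |B 1 0| ≤ |B 0 1| ∧ -|B 1 0| < B 0 0 - B 1 1 ∧ B 0 0 - B 1 1 ≤ |B 1 0| ∧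
          (|B 1 0| = |B 0 1| → 0 ≤ B 0 0 - B 1 1) := by
        rw [hB00, hB01, hB10, hB11]
        have key := (mem_normalForms_iff_isReduced (a := a) (d := d) (b := -((f : ℤ) * q.c)) hcB.ne').2
        rw [hB10] at key
        apply key
        rw [abs_of_pos (by positivity : (0 : ℤ) < f * q.a), abs_neg, abs_of_pos (by positivity : (0 : ℤ) < f * q.c),
          had, isReduced_mul_iff hfz]
        exact hqr
      have hgB : Nat.gcd (Nat.gcd (B 1 0).natAbs (B 1 1 - B 0 0).natAbs) (-B 0 1).natAbs = f := by
        rw [hB00, hB01, hB10, hB11, show d - a = -(a - d) by ring, had, neg_neg, Int.natAbs_neg, Int.natAbs_mul,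
          Int.natAbs_mul, Int.natAbs_mul, Int.natAbs_natCast, Nat.gcd_mul_left, Nat.gcd_mul_left]
        simp only [BinQF.IsPrimitive] at hqp
        rw [hqp, mul_one]
      refine ⟨⟨B, htrB, hdetB, hcB, hredB.1, hredB.2.1, hredB.2.2.1, hredB.2.2.2, hgB⟩, ?_⟩
      -- `Φ B = q`
      apply Subtype.ext
      set M : N := ⟨B, htrB, hdetB, hcB, hredB.1, hredB.2.1, hredB.2.2.1, hredB.2.2.2, hgB⟩ with hM
      have e1 : (f : ℤ) * α M = f * q.a := by rw [← hα M]; exact hB10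
      have e2 : (f : ℤ) * β M = f * q.b := by rw [← hβ M, ← had]; exact congrArg₂ (· - ·) hB00 hB11
      have e3 : (f : ℤ) * γ M = -(f * q.c) := by rw [← hγ M]; exact hB01
      have e1' := mul_left_cancel₀ hf0 e1
      have e2' := mul_left_cancel₀ hf0 e2
      have e3' : γ M = -q.c := mul_left_cancel₀ hf0 (by rw [e3]; ring)
      show (⟨α M, β M, -γ M⟩ : BinQF) = q
      rw [e1', e2', e3', neg_neg]
  exact Nat.card_congr (Equiv.ofBijective Φ hΦ)

/-- **The case `f = 1`: the normal forms with `c > 0` and PRIMITIVE form `[c, d − a, −b]` are `h(D)` in number,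
`D = r² − 4s < 0`.** [cite: HertlingLarabi2026b, §7.2 Theorem 7.9 (a)(iii)(b) and §7.3 Theorem 7.10 (c)(iii), chunks p0016–p0018]
[cite: Cox2013, §2.A Thm. 2.13] -/
theorem natCard_normalForms_pos_primitive_eq_classNumber {r s : ℤ} (hΔ : r ^ 2 - 4 * s < 0) :
    Nat.card {B : Matrix (Fin 2) (Fin 2) ℤ | B.trace = r ∧ B.det = s ∧ 0 < B 1 0 ∧ |B 1 0| ≤ |B 0 1| ∧
        -|B 1 0| < B 0 0 - B 1 1 ∧ B 0 0 - B 1 1 ≤ |B 1 0| ∧ (|B 1 0| = |B 0 1| → 0 ≤ B 0 0 - B 1 1) ∧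
        (⟨B 1 0, B 1 1 - B 0 0, -B 0 1⟩ : BinQF).IsPrimitive} = classNumber (r ^ 2 - 4 * s) := by
  have h1 := natCard_normalForms_pos_content_eq_classNumber hΔ one_pos (by simp)
  simp only [Nat.cast_one, one_pow, Int.ediv_one] at h1
  exact h1

/-! ## §2 THEOREM 7.9 (b), counted: the `GL₂(ℤ)`-classes with primitive form are `h(D)` in number -/

/-- **THEOREM 7.9 (a)(iii), (b) with THEOREM 7.10 (c)(iii), COUNTED: for `D = r² − 4s < 0` the number of
`GL₂(ℤ)`-conjugacy classes of integer `2 × 2` matrices with characteristic polynomial `t² − rt + s` whose form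
`[c, d − a, −b]` is primitive (⟺ the lattice `L = ⟨c, −a + λ₁⟩` has `𝒪(L) = ℤ[λ₁]`) equals the form class number
`h(D)`** — each such class is the class of exactly one normal form with `c > 0` («One contains matrices with
`c > 0` and corresponds to […] proper equivalence classes of positive definite binary quadratic forms»), and
these are counted by §1. [cite: HertlingLarabi2026b, §7.2 Theorem 7.9 (a)(iii)(b) and §7.3 Theorem 7.10 (c)(iii), chunks p0016–p0018]
[cite: Cox2013, §2.A Thm. 2.13] -/
theorem natCard_quot_gl2_conj_primitive_eq_classNumber {r s : ℤ} (hΔ : r ^ 2 - 4 * s < 0) :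
    Nat.card (Quot fun B B' : {B : Matrix (Fin 2) (Fin 2) ℤ // B.trace = r ∧ B.det = s ∧
        (⟨B 1 0, B 1 1 - B 0 0, -B 0 1⟩ : BinQF).IsPrimitive} =>
        ∃ P : Matrix (Fin 2) (Fin 2) ℤ, IsUnit P.det ∧ P * B.1 = B'.1 * P) = classNumber (r ^ 2 - 4 * s) := by
  rw [← natCard_normalForms_pos_primitive_eq_classNumber hΔ]
  set S := {B : Matrix (Fin 2) (Fin 2) ℤ // B.trace = r ∧ B.det = s ∧
    (⟨B 1 0, B 1 1 - B 0 0, -B 0 1⟩ : BinQF).IsPrimitive}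
  set rg : S → S → Prop := fun B B' => ∃ P : Matrix (Fin 2) (Fin 2) ℤ, IsUnit P.det ∧ P * B.1 = B'.1 * P
    with hrg
  have heg : Equivalence rg := gl_equivalence _
  set N := {B : Matrix (Fin 2) (Fin 2) ℤ | B.trace = r ∧ B.det = s ∧ 0 < B 1 0 ∧ |B 1 0| ≤ |B 0 1| ∧
    -|B 1 0| < B 0 0 - B 1 1 ∧ B 0 0 - B 1 1 ≤ |B 1 0| ∧ (|B 1 0| = |B 0 1| → 0 ≤ B 0 0 - B 1 1) ∧
    (⟨B 1 0, B 1 1 - B 0 0, -B 0 1⟩ : BinQF).IsPrimitive} with hN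
  have hΔM : ∀ M : N, M.1.trace ^ 2 - 4 * M.1.det < 0 := fun M => by rw [M.2.1, M.2.2.1]; exact hΔ
  have hmem : ∀ M : N, M.1 1 0 ≠ 0 ∧ |M.1 1 0| ≤ |M.1 0 1| ∧ -|M.1 1 0| < M.1 0 0 - M.1 1 1 ∧
      M.1 0 0 - M.1 1 1 ≤ |M.1 1 0| ∧ (|M.1 1 0| = |M.1 0 1| → 0 ≤ M.1 0 0 - M.1 1 1) := fun M =>
    ⟨M.2.2.2.1.ne', M.2.2.2.2.1, M.2.2.2.2.2.1, M.2.2.2.2.2.2.1, M.2.2.2.2.2.2.2.1⟩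
  let φ : N → Quot rg := fun M => Quot.mk rg ⟨M.1, M.2.1, M.2.2.1, M.2.2.2.2.2.2.2.2⟩
  have hφ : Function.Bijective φ := by
    constructor
    · intro M M' hMM'
      have hg : rg ⟨M.1, M.2.1, M.2.2.1, M.2.2.2.2.2.2.2.2⟩ ⟨M'.1, M'.2.1, M'.2.2.1, M'.2.2.2.2.2.2.2.2⟩ :=
        heg.eqvGen_iff.1 (Quot.eqvGen_exact hMM')
      apply Subtype.ext
      rcases (gl_conj_iff M.1 M'.1).1 hg with ⟨γ, hγ, h⟩ | ⟨γ, hγ, h⟩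
      · exact normalForm_unique_of_discr_neg (hΔM M) (hmem M) (hmem M') hγ h
      · exfalso
        have k := (pos_iff_neg_of_sl_conj_D (hΔM M) hγ h).1 M'.2.2.2.1
        exact lt_asymm k M.2.2.2.1
    · intro x
      induction x using Quot.ind with
      | _ B =>
      have hB : ¬ IsSquare (B.1.trace ^ 2 - 4 * B.1.det) :=
        not_isSquare_discr_of_neg (by rw [B.2.1, B.2.2.1]; exact hΔ)
      obtain ⟨M, ⟨htr, hdet, hc, hM⟩, γ, hγ, h⟩ := exists_sl2_conj_mem hB
      rw [B.2.1] at htr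
      rw [B.2.2.1] at hdet
      have hprimM : (⟨M 1 0, M 1 1 - M 0 0, -M 0 1⟩ : BinQF).IsPrimitive := isPrimitive_of_sl2_conj hγ h B.2.2.2
      rcases lt_or_gt_of_ne hc with hneg | hpos
      · -- use the `D_{1,−1}`-conjugate of the normal form, which has `c > 0`
        obtain ⟨htr', hdet'⟩ := trace_D_conj_and_det_D_conj M
        refine ⟨⟨!![M 0 0, -M 0 1; -M 1 0, M 1 1], htr'.trans htr, hdet'.trans hdet, ?_⟩, ?_⟩
        · simp only [BinQF.IsPrimitive, Int.natAbs_neg] at hprimM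
          simp only [Matrix.of_apply, Matrix.cons_val', Matrix.cons_val_zero, Matrix.cons_val_one,
            Matrix.cons_val_fin_one, Matrix.empty_val', abs_neg, Left.neg_pos_iff, BinQF.IsPrimitive,
            Int.natAbs_neg, neg_neg]
          exact ⟨hneg, hM.1, hM.2.1, hM.2.2.1, hM.2.2.2, hprimM⟩
        · refine Quot.sound ⟨γ * !![1, 0; 0, -1], ?_, ?_⟩
          · rw [Matrix.det_mul, hγ, one_mul, Matrix.det_fin_two_of]; norm_num
          · change γ * !![1, 0; 0, -1] * !![M 0 0, -M 0 1; -M 1 0, M 1 1] = B.1 * (γ * !![1, 0; 0, -1])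
            rw [Matrix.mul_assoc, D_mul_eq' M, ← Matrix.mul_assoc, h, Matrix.mul_assoc]
      · refine ⟨⟨M, htr, hdet, hpos, hM.1, hM.2.1, hM.2.2.1, hM.2.2.2, hprimM⟩, ?_⟩
        exact Quot.sound ⟨γ, by rw [hγ]; exact isUnit_one, h⟩
  exact (Nat.card_congr (Equiv.ofBijective φ hφ)).symm

/-! ## §3 All `GL₂(ℤ)`-classes: `Σ_{f² ∣ D} h(D/f²)` -/

/-- **The number of `GL₂(ℤ)`-conjugacy classes of integer `2 × 2` matrices with characteristic polynomial
`t² − rt + s`, `D = r² − 4s < 0`, is `Σ_{f ≥ 1, f² ∣ D} h(D/f²)`** — the classes are those of the normal forms with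
`c > 0` (Theorems 7.9 (b), 7.10 (c)(iii): `GL2ZSL2ZClassSplitting.natCard_quot_gl2_conj_eq`), sorted by the content
`f` of `[c, d − a, −b]` (the stratum `𝒪(L) = Λ_f ⊋ ℤ[λ₁]` of Remarks 6.3 (v) / Theorem 7.7 (b)), each stratum counted
by §1. [cite: HertlingLarabi2026b, §7.2 Theorems 7.7 (b), 7.9 (b) and §7.3 Theorem 7.10 (c)(iii), chunks p0015–p0018]
[cite: Cox2013, §2.A Thm. 2.13] -/
theorem natCard_quot_gl2_conj_eq_sum_classNumber {r s : ℤ} (hΔ : r ^ 2 - 4 * s < 0) :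
    Nat.card (Quot fun B B' : {B : Matrix (Fin 2) (Fin 2) ℤ // B.trace = r ∧ B.det = s} =>
        ∃ P : Matrix (Fin 2) (Fin 2) ℤ, IsUnit P.det ∧ P * B.1 = B'.1 * P) =
      ∑ f ∈ (Finset.Icc 1 (r ^ 2 - 4 * s).natAbs).filter (fun f : ℕ => f ^ 2 ∣ (r ^ 2 - 4 * s).natAbs),
        classNumber ((r ^ 2 - 4 * s) / (f : ℤ) ^ 2) := by
  rw [natCard_quot_gl2_conj_eq hΔ]
  set D := r ^ 2 - 4 * s with hD
  set N := {B : Matrix (Fin 2) (Fin 2) ℤ | B.trace = r ∧ B.det = s ∧ 0 < B 1 0 ∧ |B 1 0| ≤ |B 0 1| ∧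
    -|B 1 0| < B 0 0 - B 1 1 ∧ B 0 0 - B 1 1 ≤ |B 1 0| ∧ (|B 1 0| = |B 0 1| → 0 ≤ B 0 0 - B 1 1)} with hN
  have hfin : N.Finite :=
    (finite_normalForms r s).subset fun B hB => ⟨hB.1, hB.2.1, hB.2.2.1.ne', hB.2.2.2⟩
  set κ : Matrix (Fin 2) (Fin 2) ℤ → ℕ := fun B =>
    Nat.gcd (Nat.gcd (B 1 0).natAbs (B 1 1 - B 0 0).natAbs) (-B 0 1).natAbs with hκ
  have hmaps : ∀ B ∈ hfin.toFinset, κ B ∈ (Finset.Icc 1 D.natAbs).filter (fun f : ℕ => f ^ 2 ∣ D.natAbs) := by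
    intro B hB
    rw [Set.Finite.mem_toFinset] at hB
    obtain ⟨htr, hdet, hc, -⟩ := hB
    rw [Finset.mem_filter, Finset.mem_Icc]
    have hk0 : 0 < κ B :=
      Nat.gcd_pos_of_pos_left _ (Nat.gcd_pos_of_pos_left _ (Int.natAbs_pos.2 hc.ne'))
    have hdvd : ((κ B : ℤ)) ^ 2 ∣ D := by
      have h1 : (κ B : ℤ) ∣ B 1 0 := by
        rw [← Int.natAbs_dvd_natAbs, Int.natAbs_natCast]
        exact (Nat.gcd_dvd_left _ _).trans (Nat.gcd_dvd_left _ _)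
      have h2 : (κ B : ℤ) ∣ B 1 1 - B 0 0 := by
        rw [← Int.natAbs_dvd_natAbs, Int.natAbs_natCast]
        exact (Nat.gcd_dvd_left _ _).trans (Nat.gcd_dvd_right _ _)
      have h3 : (κ B : ℤ) ∣ -B 0 1 := by
        rw [← Int.natAbs_dvd_natAbs, Int.natAbs_natCast]
        exact Nat.gcd_dvd_right _ _
      obtain ⟨x, hx⟩ := h1
      obtain ⟨y, hy⟩ := h2
      obtain ⟨z, hz⟩ := h3
      have e : D = (B 1 1 - B 0 0) ^ 2 - 4 * (-B 0 1) * B 1 0 := by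
        rw [hD, ← htr, ← hdet, Matrix.trace_fin_two, Matrix.det_fin_two]; ring
      exact ⟨y ^ 2 - 4 * z * x, by rw [e, hx, hy, hz]; ring⟩
    have hdvd' : κ B ^ 2 ∣ D.natAbs := by
      rw [← Int.natAbs_dvd_natAbs, Int.natAbs_pow, Int.natAbs_natCast] at hdvd
      exact hdvd
    have hD0 : 0 < D.natAbs := Int.natAbs_pos.2 hΔ.ne
    exact ⟨⟨hk0, le_trans (Nat.le_self_pow two_ne_zero _) (Nat.le_of_dvd hD0 hdvd')⟩, hdvd'⟩
  rw [Nat.card_coe_set_eq, Set.ncard_eq_toFinset_card N hfin, Finset.card_eq_sum_card_fiberwise hmaps]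
  refine Finset.sum_congr rfl fun f hf => ?_
  rw [Finset.mem_filter, Finset.mem_Icc] at hf
  obtain ⟨⟨hf1, -⟩, hfD⟩ := hf
  have hfD' : ((f : ℤ)) ^ 2 ∣ D := by
    rw [← Int.natAbs_dvd_natAbs, Int.natAbs_pow, Int.natAbs_natCast]
    exact hfD
  rw [← natCard_normalForms_pos_content_eq_classNumber hΔ hf1 hfD', ← Nat.card_eq_finsetCard]
  refine Nat.card_congr (Equiv.subtypeEquivRight fun B => ?_)
  rw [Finset.mem_filter, Set.Finite.mem_toFinset]
  simp only [hN, hκ, Set.mem_setOf_eq, and_assoc]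

/-! ## §4 EXAMPLES 7.11 recomputed through class numbers -/

/-- **EXAMPLES 7.11 (i), (ii) through `h(D)`**: `t² + 5`: `D = −20`, `h(−20) = 2` (both classes primitive);
`t² + 20`: `D = −80`, `h(−80) = 4` primitive classes and `h(−80/2²) = h(−20) = 2` classes of content `2` —
`4 + 2 = 6` `GL₂(ℤ)`-classes, as counted in `SL2ZNormalFormsEnumeration.natCard_quot_gl2_conj_zero_twenty`.
[cite: HertlingLarabi2026b, §7.3 Examples 7.11 (i)(ii), chunks p0018–p0019] -/
theorem classNumber_examples_7_11 : classNumber (-20) = 2 ∧ classNumber (-80) = 4 ∧ classNumber (-5) = 0 := by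
  refine ⟨by decide, by decide, by decide⟩

/-- **EXAMPLES 7.11 (ii) through §3: `Σ_{f² ∣ 80} h(−80/f²) = h(−80) + h(−20) + h(−5) = 4 + 2 + 0 = 6`.**
[cite: HertlingLarabi2026b, §7.3 Examples 7.11 (ii), chunk p0019] -/
theorem sum_classNumber_zero_twenty :
    ∑ f ∈ (Finset.Icc 1 ((0 : ℤ) ^ 2 - 4 * 20).natAbs).filter (fun f : ℕ => f ^ 2 ∣ ((0 : ℤ) ^ 2 - 4 * 20).natAbs),
        classNumber (((0 : ℤ) ^ 2 - 4 * 20) / (f : ℤ) ^ 2) = 6 := by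
  decide +kernel

end Literature.LinearAlgebra.Matrix.GL2ZClassNumberBinaryForms
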